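import Literature.MathematicalPhysics.QuantumLattice.HeisenbergModel
import HarnessLib

/-!
# Discharges for Heisenberg-type Hamiltonians (`HeisenbergModel`): the ring is the `d = 1` torus model

Trunk **T-QLATTICE**. Sibling proof file of
`Literature/MathematicalPhysics/QuantumLattice/HeisenbergModel.lean`: it discharges the named fact
`heisenbergRing_eq_heisenbergHamiltonian_torusGraph` (`def … : Prop`, D-0014) of that file as
`theorem heisenbergRing_eq_heisenbergHamiltonian_torusGraph_holds`, from Mathlib and the API of
`SpinSystem` / `HeisenbergModel` / `LatticeGraph`. No statement of `HeisenbergModel` is changed and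
no definition is introduced.

The identity proved is the bookkeeping statement that, for `3 ≤ L`, the periodic Heisenberg ring
`heisenbergRing L n = Σ_{i ∈ ℤ/Lℤ} 𝐒_i · 𝐒_{i+1}` equals the `J = 1` Heisenberg Hamiltonian
`Σ_{{x,y} ∈ E} 𝐒_x · 𝐒_y` on the one-dimensional torus graph `torusGraph 1 L` (vertex type
`Fin 1 → ZMod L`), transported along `Fin 1 → ZMod L ≃ ZMod L`. Ingredients, all elementary:

* relabelling sites along `e : Λ ≃ Λ'` moves single-site operators, `reindexOp e (onSite x a) =
  onSite (e x) a` (entrywise; `reindexOp_apply` is definitional), hence spins, bond operators and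
  `𝐒_x · 𝐒_y` (`reindexOp_siteSpin`, `reindexOp_spinBond`, `reindexOp_spinDot`), since
  `reindexOp e` is an algebra isomorphism;
* for `3 ≤ L` the edges of the circulant graph `torusGraph 1 L` on `Fin 1 → ZMod L` are exactly
  the `L` distinct pairs `{i, i + 1}`, `i : ZMod L` (as constant functions):
  `ringBond_mem_edgeFinset_torusGraph`, `ringBond_injective` (injectivity of `i ↦ {i, i + 1}`
  uses `2 ≠ 0` in `ZMod L`, i.e. `L ∤ 2` — this is exactly where `L = 2` fails: there the ring
  counts the single edge `{0, 1}` twice), and `exists_ringBond_of_mem_edgeFinset_torusGraph`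
  (every edge `{x, x ± e₀}` is of this form because `e₀ = Pi.single 0 1` is the constant function
  `1` on `Fin 1`, `torusSite_one_single_eq_const`);
* the edge sum is then reordered along this bijection with `Finset.sum_nbij`.

## Sources

* H. Tasaki, *Physics and Mathematics of Quantum Many-Body Systems* (Springer, 2020), §2.4,
  eq. (2.4.1): `H = Σ_{{x,y} ∈ ℬ} 𝐒_x · 𝐒_y` on a finite lattice `Λ` with bond set `ℬ`; the
  periodic chain is the case `Λ = ℤ/Lℤ`, `ℬ = {{i, i+1}}`. [Tasaki2020]
* S. Friedli, Y. Velenik, *Statistical Mechanics of Lattice Systems* (CUP, 2017), §3.1: the torus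
  `(ℤ/Lℤ)^d` with nearest-neighbour edges (periodic boundary condition). [FriedliVelenik2017]
* O. Bratteli, D. W. Robinson, *Operator Algebras and Quantum Statistical Mechanics II* (2nd ed.,
  Springer 1997), §6.2.1 (covariance of the local structure under relabelling of sites).
  [BratteliRobinsonII1997]

## Mathlib / Literature status

Uses `Matrix.reindexAlgEquiv` (through `reindexOp`), `Finset.sum_nbij`, `Sym2.eq_iff`,
`Sym2.eq_swap`, `SimpleGraph.mem_edgeFinset`, `ZMod.natCast_eq_zero_iff` from Mathlib;
`onSite_apply`, `reindexOp`, `siteSpin` (`SpinSystem`), `spinBond`, `spinDot`, `spinDotSym_mk`,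
`heisenbergHamiltonian`, `heisenbergRing` (`HeisenbergModel`), `torusGraph_adj_iff`
(`LatticeGraph`).
-/

noncomputable section

open Matrix Complex

namespace Literature.MathematicalPhysics.QuantumLattice

section ReindexOnSite

variable {Λ Λ' : Type*} [Fintype Λ] [DecidableEq Λ] [Fintype Λ'] [DecidableEq Λ'] {q : ℕ}

/-! ### Relabelling sites moves single-site operators, spins and exchange operators -/

/-- Entries of a relabelled observable: `⟨σ| reindexOp e A |τ⟩ = ⟨σ ∘ e| A |τ ∘ e⟩`
(definitional unfolding of `Matrix.reindexAlgEquiv` along `σ ↦ σ ∘ e⁻¹`).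
Bratteli–Robinson II §6.2.1 (covariance). [folklore] -/
theorem reindexOp_apply (e : Λ ≃ Λ') (A : Op Λ q) (σ τ : TensorIndex Λ' q) :
    reindexOp e A σ τ = A (fun x => σ (e x)) (fun x => τ (e x)) := rfl

/-- Relabelling sites moves a single-site operator to the relabelled site:
`reindexOp e (onSite x a) = onSite (e x) a`. Bratteli–Robinson II §6.2.1 (covariance of the
local structure); Tasaki (2020) §2.2, eq. (2.2.5). [folklore] -/
theorem reindexOp_onSite (e : Λ ≃ Λ') (x : Λ) (a : Matrix (Fin q) (Fin q) ℂ) :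
    reindexOp e (onSite x a : Op Λ q) = onSite (e x) a := by
  ext σ τ
  rw [reindexOp_apply, onSite_apply, onSite_apply]
  have h : (∀ y, y ≠ x → σ (e y) = τ (e y)) ↔ ∀ y', y' ≠ e x → σ y' = τ y' := by
    constructor
    · intro h y' hy'
      have h' := h (e.symm y') fun hy => hy' (by rw [← hy, Equiv.apply_symm_apply])
      rwa [Equiv.apply_symm_apply] at h'
    · intro h y hy
      exact h (e y) fun h' => hy (e.injective h')
  rw [if_congr h rfl rfl]

/-- Relabelling sites moves spins: `reindexOp e (S^α_x) = S^α_{e x}`. Tasaki (2020) §2.2,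
eq. (2.2.5). [folklore] -/
theorem reindexOp_siteSpin (e : Λ ≃ Λ') (n : ℕ) (x : Λ) (α : Fin 3) :
    reindexOp e (siteSpin n x α : Op Λ (n + 1)) = siteSpin n (e x) α :=
  reindexOp_onSite e x _

/-- Relabelling sites moves bond operators: `reindexOp e (½(S^α_x S^α_y + S^α_y S^α_x))` is the
same bond operator at `(e x, e y)` (`reindexOp e` is an algebra isomorphism). Tasaki (2020) §2.4,
eq. (2.4.1). [folklore] -/
theorem reindexOp_spinBond (e : Λ ≃ Λ') (n : ℕ) (α : Fin 3) (x y : Λ) :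
    reindexOp e (spinBond n α x y) = spinBond n α (e x) (e y) := by
  simp only [spinBond, map_smul, map_add, map_mul, reindexOp_siteSpin]

/-- Relabelling sites moves the exchange operator: `reindexOp e (𝐒_x · 𝐒_y) = 𝐒_{e x} · 𝐒_{e y}`.
Tasaki (2020) §2.4, eq. (2.4.1). [folklore] -/
theorem reindexOp_spinDot (e : Λ ≃ Λ') (n : ℕ) (x y : Λ) :
    reindexOp e (spinDot n x y) = spinDot n (e x) (e y) := by
  simp only [spinDot, map_sum, reindexOp_spinBond]

end ReindexOnSite

section RingTorus

open Literature.Probability.LatticeModels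

/-! ### The edges of the `d = 1` torus graph are the ring bonds `{i, i+1}` -/

/-- On `Fin 1` the coordinate vector `e₀ = Pi.single k 1` is the constant function `1`. [folklore] -/
theorem torusSite_one_single_eq_const {L : ℕ} (k : Fin 1) :
    (Pi.single k 1 : TorusSite 1 L) = fun _ => 1 := by
  funext j
  rw [Subsingleton.elim k j, Pi.single_eq_same]

/-- For `3 ≤ L`, consecutive-site pairs of the ring are edges of the `d = 1` torus graph:
`{i, i+1} ∈ E(torusGraph 1 L)` (as constant functions `Fin 1 → ZMod L`); only `2 ≤ L` is used.
Friedli–Velenik (2017) §3.1. [folklore] -/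
theorem ringBond_mem_edgeFinset_torusGraph {L : ℕ} [NeZero L] (hL : 3 ≤ L) (i : ZMod L) :
    s((fun _ => i : TorusSite 1 L), fun _ => i + 1) ∈ (torusGraph 1 L).edgeFinset := by
  rw [SimpleGraph.mem_edgeFinset, SimpleGraph.mem_edgeSet, torusGraph_adj_iff]
  refine ⟨fun h => ?_, Or.inl ⟨0, ?_⟩⟩
  · have h1 : (1 : ZMod L) = 0 := by
      have h0 : i + 1 = i + 0 := by rw [add_zero]; exact (congr_fun h 0).symm
      exact add_left_cancel h0
    rw [← Nat.cast_one, ZMod.natCast_eq_zero_iff] at h1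
    have := Nat.le_of_dvd Nat.one_pos h1
    omega
  · rw [torusSite_one_single_eq_const]
    rfl

/-- For `3 ≤ L`, `i ↦ {i, i+1}` is injective on `ZMod L` (it fails for `L = 2`, where
`{0, 1} = {1, 0}`): `{i, i+1} = {j+1, j}` would force `2 = 0` in `ZMod L`. [folklore] -/
theorem ringBond_injective {L : ℕ} [NeZero L] (hL : 3 ≤ L) :
    Function.Injective fun i : ZMod L => s((fun _ => i : TorusSite 1 L), fun _ => i + 1) := by
  intro i j hij
  rcases Sym2.eq_iff.1 hij with ⟨h, -⟩ | ⟨h, h'⟩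
  · exact congr_fun h 0
  · have hi : i = j + 1 := congr_fun h 0
    have hj : i + 1 = j := congr_fun h' 0
    have h2 : (2 : ZMod L) = 0 := by
      rw [hi] at hj
      calc (2 : ZMod L) = j + 1 + 1 - j := by ring
        _ = 0 := by rw [hj, sub_self]
    rw [← Nat.cast_ofNat, ZMod.natCast_eq_zero_iff] at h2
    have := Nat.le_of_dvd Nat.two_pos h2
    omega

/-- For every edge `{x, y}` of the `d = 1` torus graph there is `i : ZMod L` with
`{x, y} = {i, i+1}` (namely `i = x₀` if `y = x + e₀`, `i = y₀` if `x = y + e₀`).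
Friedli–Velenik (2017) §3.1. [folklore] -/
theorem exists_ringBond_of_mem_edgeFinset_torusGraph {L : ℕ} [NeZero L]
    {b : Sym2 (TorusSite 1 L)} (hb : b ∈ (torusGraph 1 L).edgeFinset) :
    ∃ i : ZMod L, s((fun _ => i : TorusSite 1 L), fun _ => i + 1) = b := by
  revert hb
  refine Sym2.ind (fun x y hxy => ?_) b
  rw [SimpleGraph.mem_edgeFinset, SimpleGraph.mem_edgeSet, torusGraph_adj_iff] at hxy
  obtain ⟨-, ⟨k, hk⟩ | ⟨k, hk⟩⟩ := hxy
  · refine ⟨x 0, ?_⟩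
    have hx : (fun _ => x 0 : TorusSite 1 L) = x := funext fun j => by rw [Subsingleton.elim j 0]
    have hy : (fun _ => x 0 + 1 : TorusSite 1 L) = y := funext fun j => by
      rw [hk, torusSite_one_single_eq_const, Pi.add_apply, Subsingleton.elim j 0]
    rw [hx, hy]
  · refine ⟨y 0, ?_⟩
    have hy : (fun _ => y 0 : TorusSite 1 L) = y := funext fun j => by rw [Subsingleton.elim j 0]
    have hx : (fun _ => y 0 + 1 : TorusSite 1 L) = x := funext fun j => by
      rw [hk, torusSite_one_single_eq_const, Pi.add_apply, Subsingleton.elim j 0]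
    rw [hx, hy, Sym2.eq_swap]

/-! ### Discharge -/

/-- **Discharge of `heisenbergRing_eq_heisenbergHamiltonian_torusGraph`.** For `3 ≤ L` the
Heisenberg ring `Σ_{i ∈ ℤ/Lℤ} 𝐒_i · 𝐒_{i+1}` is the `J = 1` Heisenberg Hamiltonian
`Σ_{{x,y} ∈ E} 𝐒_x · 𝐒_y` (Tasaki (2020) §2.4, eq. (2.4.1)) on the one-dimensional torus graph
`torusGraph 1 L` (Friedli–Velenik (2017) §3.1), transported along `Fin 1 → ZMod L ≃ ZMod L`:
reorder the edge sum along the bijection `i ↦ {i, i+1}` (`Finset.sum_nbij`, using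
`ringBond_mem_edgeFinset_torusGraph`, `ringBond_injective`,
`exists_ringBond_of_mem_edgeFinset_torusGraph`) and move each term with `reindexOp_spinDot`.
[cite: Tasaki2020, §2.4, eq. (2.4.1)] -/
theorem heisenbergRing_eq_heisenbergHamiltonian_torusGraph_holds :
    ∀ n : ℕ, heisenbergRing_eq_heisenbergHamiltonian_torusGraph n := by
  intro n L _ hL
  unfold heisenbergRing heisenbergHamiltonian
  rw [Complex.ofReal_one, one_smul, map_sum]
  refine Finset.sum_nbij (fun i : ZMod L => s((fun _ => i : TorusSite 1 L), fun _ => i + 1))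
    (fun i _ => ringBond_mem_edgeFinset_torusGraph hL i) ?_ ?_ ?_
  · exact fun i _ j _ hij => ringBond_injective hL hij
  · intro b hb
    obtain ⟨i, rfl⟩ := exists_ringBond_of_mem_edgeFinset_torusGraph (Finset.mem_coe.1 hb)
    exact ⟨i, Finset.mem_coe.2 (Finset.mem_univ i), rfl⟩
  · intro i _
    rw [spinDotSym_mk, reindexOp_spinDot]
    rfl

end RingTorus

end Literature.MathematicalPhysics.QuantumLattice
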